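import Summits.CriticalPhenomena.Ising3DConformalLimit.Theorems.FKParityRobustnessIndependentStrandsJoinEventuallyUpgrade
import Summits.CriticalPhenomena.Ising3DConformalLimit.Theses.ArmHyperscaling
import HarnessLib

/-!
# SplitS2 — crux-strategist s2 (planner-cstrat-stmt-CriticalPhenomena-14625-s2-0, 2026-08-17): the typed
# decompositions of `IndependentStrandsJoin` (stmt-CriticalPhenomena-14625) available at skeleton r7 (limit-free),
# with their glue PROVED from landed theorems, plus the common strengthening S18.  Census: STRATEGY-CENSUS.md § s2.

D13 (r7-native, lattice; child 1 = sibling item stmt-CriticalPhenomena-15592 VERBATIM):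
  `MergingFloorISJ` (= `ArmHyperscaling.MergingFloor`, checked by `Iff.rfl` below) and
  `FloorToTetra := ⟨15592 body⟩ → ⟨TetraMergingEventually, unfolded⟩` (the lattice shape-transfer residual);
  glue `independentStrandsJoin_of_subs_D13 := fun h1 h2 => independentStrandsJoin_iff_tetraMergingEventually.2 (h2 h1)`
  (landed iff, p169300).  Trivial seam.  Calibration: crux ⟹ FloorToTetra unconditionally (below);
  MergingFloorISJ ∧ FloorToTetra ⟹ crux; MergingFloorISJ alone ⟹ crux is NOT formal (the ∃-shape of 15592 may be
  pinched, and `latticeApprox` floors give both cube parities), crux ⟹ MergingFloorISJ is NOT formal either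
  (lead c7 HANDOFF: odd-m tetrahedra).
D13′ (r7-native, integer shapes): `ShapeMergingEventuallyISJ` (SME, the antecedent of the lead's r5 `stub_shapeTransfer`)
  and `ShapeTransferISJ := SME → TME` (s1's child 3 verbatim), glue the same iff.  EXACT:
  `independentStrandsJoin_iff_sme_and_transfer : crux ↔ SME ∧ ShapeTransferISJ` (proved below).
S18 (common strengthening of this crux AND 15592; lead c7's planner note): `TetraFloorAllCubes` — the merging floor at
  the corner tetrahedra of ALL cubes `{0,m}³` (both parities of m).  Typed only.
-/

namespace Summit.CriticalPhenomena.Ising3DConformalLimit.Theses.FKParityRobustness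

open scoped BigOperators Topology Manifold Classical MeasureTheory ProbabilityTheory Matrix InnerProductSpace ComplexConjugate ContinuousMap
open Filter Set Function TopologicalSpace MeasureTheory

/-- D13 child 1/2 — VERBATIM item stmt-CriticalPhenomena-15592 (`ArmHyperscaling.MergingFloor`, crux r3 there, staffed). -/
def MergingFloorISJ : Prop :=
  ∃ x ∈ Literature.Probability.LatticeModels.NonCoincident 3 4, ∃ c : ℝ, 0 < c ∧ ∀ᶠ δ in nhdsWithin (0:ℝ) (Set.Ioi 0), c * (Literature.Probability.LatticeModels.criticalCorr 3 2 ![Literature.Probability.LatticeModels.latticeApprox δ (x 0), Literature.Probability.LatticeModels.latticeApprox δ (x 1)] * Literature.Probability.LatticeModels.criticalCorr 3 2 ![Literature.Probability.LatticeModels.latticeApprox δ (x 2), Literature.Probability.LatticeModels.latticeApprox δ (x 3)]) ≤ -(Literature.Probability.LatticeModels.criticalCorr 3 4 (fun i => Literature.Probability.LatticeModels.latticeApprox δ (x i)) - (Literature.Probability.LatticeModels.criticalCorr 3 2 ![Literature.Probability.LatticeModels.latticeApprox δ (x 0), Literature.Probability.LatticeModels.latticeApprox δ (x 1)] * Literature.Probability.LatticeModels.criticalCorr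 3 2 ![Literature.Probability.LatticeModels.latticeApprox δ (x 2), Literature.Probability.LatticeModels.latticeApprox δ (x 3)] + Literature.Probability.LatticeModels.criticalCorr 3 2 ![Literature.Probability.LatticeModels.latticeApprox δ (x 0), Literature.Probability.LatticeModels.latticeApprox δ (x 2)] * Literature.Probability.LatticeModels.criticalCorr 3 2 ![Literature.Probability.LatticeModels.latticeApprox δ (x 1), Literature.Probability.LatticeModels.latticeApprox δ (x 3)] + Literature.Probability.LatticeModels.criticalCorr 3 2 ![Literature.Probability.LatticeModels.latticeApprox δ (x 0), Literature.Probability.LatticeModels.latticeApprox δ (x 3)] * Literature.Probability.LatticeModels.criticalCorr 3 2 ![Literature.Probability.LatticeModels.latticeApprox δ (x 1), Literature.Probability.LatticeModels.latticeApprox δ (x 2)]))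

/-- D13 child 2/2 — the lattice shape-transfer residual: a merging floor at SOME real non-coincident quadruple for all
small δ (child 1) implies tetrahedral far merging at all large integer scales (≡ the crux, `independentStrandsJoin_iff_tetraMergingEventually`). -/
def FloorToTetra : Prop :=
  (∃ x ∈ Literature.Probability.LatticeModels.NonCoincident 3 4, ∃ c : ℝ, 0 < c ∧ ∀ᶠ δ in nhdsWithin (0:ℝ) (Set.Ioi 0), c * (Literature.Probability.LatticeModels.criticalCorr 3 2 ![Literature.Probability.LatticeModels.latticeApprox δ (x 0), Literature.Probability.LatticeModels.latticeApprox δ (x 1)] * Literature.Probability.LatticeModels.criticalCorr 3 2 ![Literature.Probability.LatticeModels.latticeApprox δ (x 2), Literature.Probability.LatticeModels.latticeApprox δ (x 3)]) ≤ -(Literature.Probability.LatticeModels.criticalCorr 3 4 (fun i => Literature.Probability.LatticeModels.latticeApprox δ (x i)) - (Literature.Probability.LatticeModels.criticalCorr 3 2 ![Literature.Probability.LatticeModels.latticeApprox δ (x 0), Literature.Probability.LatticeModels.latticeApprox δ (x 1)] * Literature.Probability.LatticeModels.criticalCorr 3 2 ![Literature.Probability.LatticeModels.latticeApprox δ (x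 2), Literature.Probability.LatticeModels.latticeApprox δ (x 3)] + Literature.Probability.LatticeModels.criticalCorr 3 2 ![Literature.Probability.LatticeModels.latticeApprox δ (x 0), Literature.Probability.LatticeModels.latticeApprox δ (x 2)] * Literature.Probability.LatticeModels.criticalCorr 3 2 ![Literature.Probability.LatticeModels.latticeApprox δ (x 1), Literature.Probability.LatticeModels.latticeApprox δ (x 3)] + Literature.Probability.LatticeModels.criticalCorr 3 2 ![Literature.Probability.LatticeModels.latticeApprox δ (x 0), Literature.Probability.LatticeModels.latticeApprox δ (x 3)] * Literature.Probability.LatticeModels.criticalCorr 3 2 ![Literature.Probability.LatticeModels.latticeApprox δ (x 1), Literature.Probability.LatticeModels.latticeApprox δ (x 2)]))) →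
  (let tetra : Fin 4 → Literature.Probability.LatticeModels.Site 3 := ![![-1, -1, -1], ![1, 1, -1], ![1, -1, 1], ![-1, 1, 1]]; ∃ c : ℝ, 0 < c ∧ ∃ l₁ : ℕ, ∀ l : ℕ, l₁ ≤ l → Literature.Probability.LatticeModels.criticalCorr 3 4 (fun i => (l : ℤ) • tetra i) - (Literature.Probability.LatticeModels.criticalCorr 3 2 ![(l : ℤ) • tetra 0, (l : ℤ) • tetra 1] * Literature.Probability.LatticeModels.criticalCorr 3 2 ![(l : ℤ) • tetra 2, (l : ℤ) • tetra 3] + Literature.Probability.LatticeModels.criticalCorr 3 2 ![(l : ℤ) • tetra 0, (l : ℤ) • tetra 2] * Literature.Probability.LatticeModels.criticalCorr 3 2 ![(l : ℤ) • tetra 1, (l : ℤ) • tetra 3] + Literature.Probability.LatticeModels.criticalCorr 3 2 ![(l : ℤ) • tetra 0, (l : ℤ) • tetra 3] * Literature.Probability.LatticeModels.criticalCorr 3 2 ![(l : ℤ) • tetra 1, (l : ℤ) • tetra 2]) ≤ -(c * (Literature.Probability.LatticeModels.criticalCorr 3 2 ![(l : ℤ) • tetra 0, (l : ℤ) • tetra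 1] * Literature.Probability.LatticeModels.criticalCorr 3 2 ![(l : ℤ) • tetra 2, (l : ℤ) • tetra 3])))

/-- Dedup certificate: child 1 IS the sibling route decl (same text, same elaboration context). -/
example : MergingFloorISJ ↔ Summit.CriticalPhenomena.Ising3DConformalLimit.Theses.ArmHyperscaling.MergingFloor := Iff.rfl

/-- D13 glue, PROVED from the landed limit-free iff (p169300): `MergingFloorISJ → FloorToTetra → IndependentStrandsJoin`. -/
theorem independentStrandsJoin_of_subs_D13 : MergingFloorISJ → FloorToTetra → IndependentStrandsJoin :=
  fun h1 h2 => Summit.CriticalPhenomena.Ising3DConformalLimit.Cruxes.IndependentStrandsJoin.PinchToTetra.independentStrandsJoin_iff_tetraMergingEventually.2 (h2 h1)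

/-- Calibration: the crux implies child 2 outright (so child 2 is not stronger than the crux). -/
example (h : IndependentStrandsJoin) : FloorToTetra :=
  fun _ => Summit.CriticalPhenomena.Ising3DConformalLimit.Cruxes.IndependentStrandsJoin.PinchToTetra.independentStrandsJoin_iff_tetraMergingEventually.1 h

/-- D13′ child 1/2 — `ShapeMergingEventually` (SME): far merging at all large integer dilations of SOME injective lattice
shape (the antecedent of the lead's r5 `stub_shapeTransfer`; implied by the crux with `a := tetra`). -/
def ShapeMergingEventuallyISJ : Prop :=
  (∃ c : ℝ, 0 < c ∧ ∃ a : Fin 4 → Literature.Probability.LatticeModels.Site 3, Function.Injective a ∧ ∃ L₁ : ℕ, ∀ L : ℕ, L₁ ≤ L → Literature.Probability.LatticeModels.criticalCorr 3 4 (fun i => (L : ℤ) • a i) - (Literature.Probability.LatticeModels.criticalCorr 3 2 ![(L : ℤ) • a 0, (L : ℤ) • a 1] * Literature.Probability.LatticeModels.criticalCorr 3 2 ![(L : ℤ) • a 2, (L : ℤ) • a 3] + Literature.Probability.LatticeModels.criticalCorr 3 2 ![(L : ℤ) • a 0, (L : ℤ) • a 2] * Literature.Probability.LatticeModels.criticalCorr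 3 2 ![(L : ℤ) • a 1, (L : ℤ) • a 3] + Literature.Probability.LatticeModels.criticalCorr 3 2 ![(L : ℤ) • a 0, (L : ℤ) • a 3] * Literature.Probability.LatticeModels.criticalCorr 3 2 ![(L : ℤ) • a 1, (L : ℤ) • a 2]) ≤ -(c * (Literature.Probability.LatticeModels.criticalCorr 3 2 ![(L : ℤ) • a 0, (L : ℤ) • a 1] * Literature.Probability.LatticeModels.criticalCorr 3 2 ![(L : ℤ) • a 2, (L : ℤ) • a 3])))

/-- D13′ child 2/2 — s1's `ShapeTransferISJ` verbatim: SME → TME. -/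
def ShapeTransferISJ : Prop :=
  (∃ c : ℝ, 0 < c ∧ ∃ a : Fin 4 → Literature.Probability.LatticeModels.Site 3, Function.Injective a ∧ ∃ L₁ : ℕ, ∀ L : ℕ, L₁ ≤ L → Literature.Probability.LatticeModels.criticalCorr 3 4 (fun i => (L : ℤ) • a i) - (Literature.Probability.LatticeModels.criticalCorr 3 2 ![(L : ℤ) • a 0, (L : ℤ) • a 1] * Literature.Probability.LatticeModels.criticalCorr 3 2 ![(L : ℤ) • a 2, (L : ℤ) • a 3] + Literature.Probability.LatticeModels.criticalCorr 3 2 ![(L : ℤ) • a 0, (L : ℤ) • a 2] * Literature.Probability.LatticeModels.criticalCorr 3 2 ![(L : ℤ) • a 1, (L : ℤ) • a 3] + Literature.Probability.LatticeModels.criticalCorr 3 2 ![(L : ℤ) • a 0, (L : ℤ) • a 3] * Literature.Probability.LatticeModels.criticalCorr 3 2 ![(L : ℤ) • a 1, (L : ℤ) • a 2]) ≤ -(c * (Literature.Probability.LatticeModels.criticalCorr 3 2 ![(L : ℤ) • a 0, (L : ℤ) • a 1] * Literature.Probability.LatticeModels.criticalCorr 3 2 ![(L : ℤ) • a 2, (L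 : ℤ) • a 3]))) → (let tetra : Fin 4 → Literature.Probability.LatticeModels.Site 3 := ![![-1, -1, -1], ![1, 1, -1], ![1, -1, 1], ![-1, 1, 1]]; ∃ c : ℝ, 0 < c ∧ ∃ l₁ : ℕ, ∀ l : ℕ, l₁ ≤ l → Literature.Probability.LatticeModels.criticalCorr 3 4 (fun i => (l : ℤ) • tetra i) - (Literature.Probability.LatticeModels.criticalCorr 3 2 ![(l : ℤ) • tetra 0, (l : ℤ) • tetra 1] * Literature.Probability.LatticeModels.criticalCorr 3 2 ![(l : ℤ) • tetra 2, (l : ℤ) • tetra 3] + Literature.Probability.LatticeModels.criticalCorr 3 2 ![(l : ℤ) • tetra 0, (l : ℤ) • tetra 2] * Literature.Probability.LatticeModels.criticalCorr 3 2 ![(l : ℤ) • tetra 1, (l : ℤ) • tetra 3] + Literature.Probability.LatticeModels.criticalCorr 3 2 ![(l : ℤ) • tetra 0, (l : ℤ) • tetra 3] * Literature.Probability.LatticeModels.criticalCorr 3 2 ![(l : ℤ) • tetra 1, (l : ℤ) • tetra 2]) ≤ -(c * (Literature.Probability.LatticeModels.criticalCorr 3 2 ![(l : ℤ) • tetra 0,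 (l : ℤ) • tetra 1] * Literature.Probability.LatticeModels.criticalCorr 3 2 ![(l : ℤ) • tetra 2, (l : ℤ) • tetra 3])))

/-- D13′ glue, PROVED (same landed iff). -/
theorem independentStrandsJoin_of_subs_D13' : ShapeMergingEventuallyISJ → ShapeTransferISJ → IndependentStrandsJoin :=
  fun h1 h2 => Summit.CriticalPhenomena.Ising3DConformalLimit.Cruxes.IndependentStrandsJoin.PinchToTetra.independentStrandsJoin_iff_tetraMergingEventually.2 (h2 h1)

/-- Calibration for D13′: crux ⟹ SME (take the tetrahedron itself) and crux ⟹ ShapeTransferISJ; hence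
`crux ↔ SME ∧ ShapeTransferISJ` — the family is EXACT. -/
theorem independentStrandsJoin_iff_sme_and_transfer :
    IndependentStrandsJoin ↔ (ShapeMergingEventuallyISJ ∧ ShapeTransferISJ) := by
  constructor
  · intro h
    have hT := Summit.CriticalPhenomena.Ising3DConformalLimit.Cruxes.IndependentStrandsJoin.PinchToTetra.independentStrandsJoin_iff_tetraMergingEventually.1 h
    refine ⟨?_, fun _ => hT⟩
    obtain ⟨c, hc, l₁, hl⟩ := hT
    refine ⟨c, hc, Summit.CriticalPhenomena.Ising3DConformalLimit.Cruxes.ParityRobustMerging.PlaquetteXorSurgery.tetra,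
      Summit.CriticalPhenomena.Ising3DConformalLimit.Cruxes.ParityRobustMerging.PlaquetteXorSurgery.tetra_inj, l₁, fun L hL => ?_⟩
    exact hl L hL
  · rintro ⟨h1, h2⟩
    exact independentStrandsJoin_of_subs_D13' h1 h2

/-- S18 — the common strengthening (typed only): merging floor at the corner tetrahedra of ALL cubes `{0,m}³`. -/
def TetraFloorAllCubes : Prop :=
  ∃ c : ℝ, 0 < c ∧ ∃ m₁ : ℕ, ∀ m : ℕ, m₁ ≤ m →
    (let T : Fin 4 → Literature.Probability.LatticeModels.Site 3 :=
      ![![0, 0, 0], ![(m : ℤ), (m : ℤ), 0], ![(m : ℤ), 0, (m : ℤ)], ![0, (m : ℤ), (m : ℤ)]];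
     Literature.Probability.LatticeModels.criticalCorr 3 4 T -
        (Literature.Probability.LatticeModels.criticalCorr 3 2 ![T 0, T 1] * Literature.Probability.LatticeModels.criticalCorr 3 2 ![T 2, T 3] +
          Literature.Probability.LatticeModels.criticalCorr 3 2 ![T 0, T 2] * Literature.Probability.LatticeModels.criticalCorr 3 2 ![T 1, T 3] +
          Literature.Probability.LatticeModels.criticalCorr 3 2 ![T 0, T 3] * Literature.Probability.LatticeModels.criticalCorr 3 2 ![T 1, T 2]) ≤
      -(c * (Literature.Probability.LatticeModels.criticalCorr 3 2 ![T 0, T 1] * Literature.Probability.LatticeModels.criticalCorr 3 2 ![T 2, T 3])))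

end Summit.CriticalPhenomena.Ising3DConformalLimit.Theses.FKParityRobustness
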